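import Summits.QuantumFields.QCD.Theorems.HeatSlicedQuarksWilsonLichnerowiczDefs

/-!
# Wilson–Lichnerowicz bound (stmt-QuantumFields-8874): `ℓ²` bookkeeping, transports, spin matrices

Elementary lemmas about the objects of `HeatSlicedQuarksWilsonLichnerowiczDefs`: sesquilinearity and
symmetry of `ip`, `Re⟨u,u⟩ = nsq u`, polarisation `‖u ± w‖²`; the transport calculus
(composition = product of fields with summed offsets, difference, identity, isometry for unitary
fields, adjoint = shifted adjoint field with opposite offset) and the weighted Schur bound
`‖⟨w, T_{G,e} u⟩‖ ≤ (3/2) Σ_x ρ(x)(|w|²(x) + |u|²(x+e))` for `‖G(x)_{ab}‖ ≤ ρ(x)`; the spin-matrix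
calculus (commutes with transports, multiplicative, adjoint `Γᴴ`, isometry).  Mathlib only.
-/

noncomputable section

namespace Summit.QuantumFields.QCD.Theorems.WilsonLichnerowicz

open Literature.Probability.LatticeModels Matrix
open scoped ComplexConjugate

variable {L : ℕ}

/-! ## Site norms -/

/-- `siteSq` is nonnegative. -/
theorem siteSq_nonneg (u : Fld L) (x : TorusSite 4 L) : 0 ≤ siteSq u x :=
  Finset.sum_nonneg fun _ _ => Finset.sum_nonneg fun _ _ => by positivity

/-! ## The `ℓ²` inner product -/

section Inner

variable [NeZero L]

/-- Additivity of `ip` in the first slot. -/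
theorem ip_add_left (u u' w : Fld L) : ip (u + u') w = ip u w + ip u' w := by
  simp only [ip, Pi.add_apply, map_add, add_mul, Finset.sum_add_distrib]

/-- Additivity of `ip` in the second slot. -/
theorem ip_add_right (u w w' : Fld L) : ip u (w + w') = ip u w + ip u w' := by
  simp only [ip, Pi.add_apply, mul_add, Finset.sum_add_distrib]

/-- `ip` of a negation in the first slot. -/
theorem ip_neg_left (u w : Fld L) : ip (-u) w = -ip u w := by
  simp only [ip, Pi.neg_apply, map_neg, neg_mul, Finset.sum_neg_distrib]

/-- `ip` of a negation in the second slot. -/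
theorem ip_neg_right (u w : Fld L) : ip u (-w) = -ip u w := by
  simp only [ip, Pi.neg_apply, mul_neg, Finset.sum_neg_distrib]

/-- Subtractivity of `ip` in the first slot. -/
theorem ip_sub_left (u u' w : Fld L) : ip (u - u') w = ip u w - ip u' w := by
  simp only [sub_eq_add_neg, ip_add_left, ip_neg_left]

/-- Subtractivity of `ip` in the second slot. -/
theorem ip_sub_right (u w w' : Fld L) : ip u (w - w') = ip u w - ip u w' := by
  simp only [sub_eq_add_neg, ip_add_right, ip_neg_right]

/-- Conjugate-linearity of `ip` in the first slot. -/
theorem ip_smul_left (c : ℂ) (u w : Fld L) : ip (c • u) w = conj c * ip u w := by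
  simp only [ip, Pi.smul_apply, smul_eq_mul, map_mul, Finset.mul_sum, mul_assoc]

/-- Linearity of `ip` in the second slot. -/
theorem ip_smul_right (c : ℂ) (u w : Fld L) : ip u (c • w) = c * ip u w := by
  simp only [ip, Pi.smul_apply, smul_eq_mul, Finset.mul_sum]
  exact Finset.sum_congr rfl fun i _ => by ring

/-- `ip` of a finite sum in the first slot. -/
theorem ip_sum_left {ι : Type*} (s : Finset ι) (f : ι → Fld L) (w : Fld L) :
    ip (∑ k ∈ s, f k) w = ∑ k ∈ s, ip (f k) w := by
  classical
  induction s using Finset.induction_on with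
  | empty => simp [ip]
  | insert a s ha ih => rw [Finset.sum_insert ha, Finset.sum_insert ha, ip_add_left, ih]

/-- `ip` of a finite sum in the second slot. -/
theorem ip_sum_right {ι : Type*} (s : Finset ι) (u : Fld L) (f : ι → Fld L) :
    ip u (∑ k ∈ s, f k) = ∑ k ∈ s, ip u (f k) := by
  classical
  induction s using Finset.induction_on with
  | empty => simp [ip]
  | insert a s ha ih => rw [Finset.sum_insert ha, Finset.sum_insert ha, ip_add_right, ih]

/-- Hermitian symmetry: `conj ⟨u, w⟩ = ⟨w, u⟩`. -/
theorem conj_ip (u w : Fld L) : conj (ip u w) = ip w u := by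
  simp only [ip, map_sum, map_mul, Complex.conj_conj]
  exact Finset.sum_congr rfl fun i _ => by ring

/-- The real part of `ip` is symmetric. -/
theorem re_ip_comm (u w : Fld L) : (ip u w).re = (ip w u).re := by
  rw [← conj_ip u w, Complex.conj_re]

/-- `Re ⟨u, u⟩ = Σ ‖u i‖²`. -/
theorem re_ip_self (u : Fld L) : (ip u u).re = nsq u := by
  rw [ip, nsq, Complex.re_sum]
  refine Finset.sum_congr rfl fun i _ => ?_
  rw [← Complex.normSq_eq_conj_mul_self, Complex.ofReal_re, Complex.normSq_eq_norm_sq]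

/-- `nsq` is nonnegative. -/
theorem nsq_nonneg (u : Fld L) : 0 ≤ nsq u :=
  Finset.sum_nonneg fun _ _ => by positivity

/-- The squared norm is the sum of the site contributions. -/
theorem nsq_eq_sum_siteSq (u : Fld L) : nsq u = ∑ x, siteSq u x := by
  simp only [nsq, siteSq, Fintype.sum_prod_type]

/-- `‖u + w‖² = ‖u‖² + ‖w‖² + 2 Re⟨u, w⟩`. -/
theorem nsq_add (u w : Fld L) : nsq (u + w) = nsq u + nsq w + 2 * (ip u w).re := by
  rw [← re_ip_self, ← re_ip_self, ← re_ip_self, ip_add_left, ip_add_right, ip_add_right,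
    Complex.add_re, Complex.add_re, Complex.add_re, re_ip_comm w u]
  ring

/-- `‖-u‖² = ‖u‖²`. -/
theorem nsq_neg (u : Fld L) : nsq (-u) = nsq u := by
  simp only [nsq, Pi.neg_apply, norm_neg]

/-- `‖u - w‖² = ‖u‖² + ‖w‖² - 2 Re⟨u, w⟩`. -/
theorem nsq_sub (u w : Fld L) : nsq (u - w) = nsq u + nsq w - 2 * (ip u w).re := by
  rw [sub_eq_add_neg, nsq_add, nsq_neg, ip_neg_right, Complex.neg_re]
  ring

/-- `‖c • u‖² = ‖c‖² ‖u‖²`. -/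
theorem nsq_smul (c : ℂ) (u : Fld L) : nsq (c • u) = ‖c‖ ^ 2 * nsq u := by
  simp only [nsq, Pi.smul_apply, smul_eq_mul, norm_mul, mul_pow, Finset.mul_sum]

end Inner

/-! ## Covariant transports -/

/-- Composition of transports is a transport: fields multiply (the second one shifted), offsets
add. -/
theorem transport_transport (G G' : TorusSite 4 L → Matrix (Fin 3) (Fin 3) ℂ)
    (e e' : TorusSite 4 L) (u : Fld L) :
    transport G e (transport G' e' u) = transport (fun x => G x * G' (x + e)) (e + e') u := by
  funext p
  simp only [transport_apply, Matrix.mul_apply, Finset.mul_sum, Finset.sum_mul, add_assoc]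
  rw [Finset.sum_comm]
  exact Finset.sum_congr rfl fun c _ => Finset.sum_congr rfl fun b _ => by ring

/-- Transports with the same offset subtract fieldwise. -/
theorem transport_sub_transport (G G' : TorusSite 4 L → Matrix (Fin 3) (Fin 3) ℂ)
    (e : TorusSite 4 L) (u : Fld L) :
    transport G e u - transport G' e u = transport (fun x => G x - G' x) e u := by
  funext p
  simp only [Pi.sub_apply, transport_apply, Matrix.sub_apply, sub_mul, Finset.sum_sub_distrib]

/-- The transport by the identity field with zero offset is the identity. -/
theorem transport_one_zero (u : Fld L) :
    transport (fun _ : TorusSite 4 L => (1 : Matrix (Fin 3) (Fin 3) ℂ)) 0 u = u := by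
  funext p
  simp only [transport_apply, Matrix.one_apply, ite_mul, one_mul, zero_mul,
    Finset.sum_ite_eq, Finset.mem_univ, if_true, add_zero]

/-- Transports with pointwise equal fields and equal offsets agree. -/
theorem transport_congr {G G' : TorusSite 4 L → Matrix (Fin 3) (Fin 3) ℂ} {e e' : TorusSite 4 L}
    (hG : ∀ x, G x = G' x) (he : e = e') : transport G e = transport G' e' := by
  rw [show G = G' from funext hG, he]

/-- `Re⟨f, f⟩ = Σ ‖f b‖²` for a colour vector. -/
private theorem re_star_dotProduct_self (f : Fin 3 → ℂ) :
    (star f ⬝ᵥ f).re = ∑ b, ‖f b‖ ^ 2 := by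
  rw [dotProduct, Complex.re_sum]
  refine Finset.sum_congr rfl fun i _ => ?_
  rw [Pi.star_apply, Complex.star_def, ← Complex.normSq_eq_conj_mul_self, Complex.ofReal_re,
    Complex.normSq_eq_norm_sq]

/-- A colour isometry (`Aᴴ A = 1`) preserves `Σ_a ‖·‖²`. -/
theorem sum_norm_sq_mulVec (A : Matrix (Fin 3) (Fin 3) ℂ) (hA : Aᴴ * A = 1) (f : Fin 3 → ℂ) :
    ∑ a, ‖∑ b, A a b * f b‖ ^ 2 = ∑ b, ‖f b‖ ^ 2 := by
  have h : ∀ a, ∑ b, A a b * f b = (A *ᵥ f) a := fun a => rfl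
  simp only [h]
  rw [← re_star_dotProduct_self, ← re_star_dotProduct_self, star_mulVec, ← dotProduct_mulVec,
    mulVec_mulVec, hA, one_mulVec]

/-- A transport by colour isometries moves the site norms: `|T u|²(x) = |u|²(x + e)`. -/
theorem siteSq_transport (G : TorusSite 4 L → Matrix (Fin 3) (Fin 3) ℂ) (e : TorusSite 4 L)
    (hG : ∀ x, (G x)ᴴ * G x = 1) (u : Fld L) (x : TorusSite 4 L) :
    siteSq (transport G e u) x = siteSq u (x + e) := by
  simp only [siteSq, transport_apply]
  rw [Finset.sum_comm, Finset.sum_comm (f := fun a α => ‖u (x + e, a, α)‖ ^ 2)]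
  exact Finset.sum_congr rfl fun α _ => sum_norm_sq_mulVec (G x) (hG x) fun b => u (x + e, b, α)

section TransportInner

variable [NeZero L]

/-- A transport by colour isometries is an isometry of `ℓ²`. -/
theorem nsq_transport (G : TorusSite 4 L → Matrix (Fin 3) (Fin 3) ℂ) (e : TorusSite 4 L)
    (hG : ∀ x, (G x)ᴴ * G x = 1) (u : Fld L) : nsq (transport G e u) = nsq u := by
  simp only [nsq_eq_sum_siteSq, siteSq_transport G e hG]
  exact Fintype.sum_equiv (Equiv.addRight e) _ _ fun x => rfl

/-- The adjoint of a transport is the transport by the shifted adjoint field with the opposite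
offset: `⟨w, T_{G,e} u⟩ = ⟨T_{G(·-e)ᴴ,-e} w, u⟩`. -/
theorem ip_transport (G : TorusSite 4 L → Matrix (Fin 3) (Fin 3) ℂ) (e : TorusSite 4 L)
    (w u : Fld L) :
    ip w (transport G e u) = ip (transport (fun x => (G (x - e))ᴴ) (-e) w) u := by
  simp only [ip, transport_apply, Fintype.sum_prod_type, map_sum, map_mul,
    Matrix.conjTranspose_apply, Complex.star_def, Complex.conj_conj, Finset.mul_sum,
    Finset.sum_mul]
  refine Fintype.sum_equiv (Equiv.addRight e) _ _ fun x => ?_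
  simp only [Equiv.coe_addRight, add_sub_cancel_right, add_neg_cancel_right]
  calc ∑ a : Fin 3, ∑ α : Fin 4, ∑ b : Fin 3, conj (w (x, a, α)) * (G x a b * u (x + e, b, α))
      = ∑ a : Fin 3, ∑ b : Fin 3, ∑ α : Fin 4, conj (w (x, a, α)) * (G x a b * u (x + e, b, α)) :=
        Finset.sum_congr rfl fun a _ => Finset.sum_comm
    _ = ∑ b : Fin 3, ∑ a : Fin 3, ∑ α : Fin 4, conj (w (x, a, α)) * (G x a b * u (x + e, b, α)) :=
        Finset.sum_comm
    _ = ∑ b : Fin 3, ∑ α : Fin 4, ∑ a : Fin 3, G x a b * conj (w (x, a, α)) * u (x + e, b, α) := by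
        refine Finset.sum_congr rfl fun b _ => ?_
        rw [Finset.sum_comm]
        exact Finset.sum_congr rfl fun α _ => Finset.sum_congr rfl fun a _ => by ring

/-- Weighted Schur bound for a transport: if `‖G(x)_{ab}‖ ≤ ρ x` entrywise then
`‖⟨w, T_{G,e} u⟩‖ ≤ (3/2) Σ_x ρ(x) (|w|²(x) + |u|²(x + e))`. -/
theorem norm_ip_transport_le (G : TorusSite 4 L → Matrix (Fin 3) (Fin 3) ℂ) (e : TorusSite 4 L)
    (ρ : TorusSite 4 L → ℝ) (hG : ∀ x a b, ‖G x a b‖ ≤ ρ x) (w u : Fld L) :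
    ‖ip w (transport G e u)‖ ≤ (3 / 2) * ∑ x, ρ x * (siteSq w x + siteSq u (x + e)) := by
  have hρ : ∀ x, 0 ≤ ρ x := fun x => (norm_nonneg _).trans (hG x 0 0)
  simp only [ip, transport_apply, Fintype.sum_prod_type, Finset.mul_sum]
  refine (norm_sum_le _ _).trans (Finset.sum_le_sum fun x _ => ?_)
  -- pointwise bound at the site `x`
  have hterm : ∀ (a : Fin 3) (α : Fin 4) (b : Fin 3),
      ‖conj (w (x, a, α)) * (G x a b * u (x + e, b, α))‖ ≤
        ρ x * ((‖w (x, a, α)‖ ^ 2 + ‖u (x + e, b, α)‖ ^ 2) / 2) := by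
    intro a α b
    rw [norm_mul, norm_mul, Complex.norm_conj]
    have hw := norm_nonneg (w (x, a, α))
    have hu := norm_nonneg (u (x + e, b, α))
    have h2 := two_mul_le_add_sq ‖w (x, a, α)‖ ‖u (x + e, b, α)‖
    calc ‖w (x, a, α)‖ * (‖G x a b‖ * ‖u (x + e, b, α)‖)
        = ‖G x a b‖ * (‖w (x, a, α)‖ * ‖u (x + e, b, α)‖) := by ring
      _ ≤ ρ x * (‖w (x, a, α)‖ * ‖u (x + e, b, α)‖) :=
          mul_le_mul_of_nonneg_right (hG x a b) (mul_nonneg hw hu)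
      _ ≤ ρ x * ((‖w (x, a, α)‖ ^ 2 + ‖u (x + e, b, α)‖ ^ 2) / 2) :=
          mul_le_mul_of_nonneg_left (by linarith) (hρ x)
  have h1 : ∑ a : Fin 3, ∑ α : Fin 4, ∑ _b : Fin 3, ‖w (x, a, α)‖ ^ 2 = 3 * siteSq w x := by
    simp only [Finset.sum_const, Finset.card_univ, Fintype.card_fin, nsmul_eq_mul, Nat.cast_ofNat,
      siteSq, Finset.mul_sum]
  have h2 : ∑ _a : Fin 3, ∑ α : Fin 4, ∑ b : Fin 3, ‖u (x + e, b, α)‖ ^ 2 =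
      3 * siteSq u (x + e) := by
    rw [Finset.sum_const, Finset.card_univ, Fintype.card_fin, nsmul_eq_mul, Nat.cast_ofNat, siteSq,
      Finset.sum_comm]
  have h3 : ∀ (a : Fin 3) (α : Fin 4) (b : Fin 3),
      ρ x * ((‖w (x, a, α)‖ ^ 2 + ‖u (x + e, b, α)‖ ^ 2) / 2) =
        ρ x / 2 * ‖w (x, a, α)‖ ^ 2 + ρ x / 2 * ‖u (x + e, b, α)‖ ^ 2 := by
    intros; ring
  calc ‖∑ a, ∑ α, ∑ b, conj (w (x, a, α)) * (G x a b * u (x + e, b, α))‖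
      ≤ ∑ a, ∑ α, ∑ b, ‖conj (w (x, a, α)) * (G x a b * u (x + e, b, α))‖ := by
        refine (norm_sum_le _ _).trans (Finset.sum_le_sum fun a _ => ?_)
        exact (norm_sum_le _ _).trans (Finset.sum_le_sum fun α _ => norm_sum_le _ _)
    _ ≤ ∑ a, ∑ α, ∑ b, ρ x * ((‖w (x, a, α)‖ ^ 2 + ‖u (x + e, b, α)‖ ^ 2) / 2) :=
        Finset.sum_le_sum fun a _ => Finset.sum_le_sum fun α _ =>
          Finset.sum_le_sum fun b _ => hterm a α b
    _ = (3 / 2) * (ρ x * (siteSq w x + siteSq u (x + e))) := by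
        simp only [h3, Finset.sum_add_distrib, ← Finset.mul_sum, h1, h2]
        ring

end TransportInner

/-! ## Spin matrices acting on the spinor index -/

/-- Spin matrices commute with colour transports. -/
theorem spin_transport (Γ : Matrix (Fin 4) (Fin 4) ℂ) (G : TorusSite 4 L → Matrix (Fin 3) (Fin 3) ℂ)
    (e : TorusSite 4 L) (u : Fld L) :
    spin Γ (transport G e u) = transport G e (spin Γ u) := by
  funext p
  simp only [spin_apply, transport_apply, Finset.mul_sum]
  rw [Finset.sum_comm]
  exact Finset.sum_congr rfl fun b _ => Finset.sum_congr rfl fun β _ => by ring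

/-- `spin` is multiplicative. -/
theorem spin_spin (Γ Γ' : Matrix (Fin 4) (Fin 4) ℂ) (u : Fld L) :
    spin Γ (spin Γ' u) = spin (Γ * Γ') u := by
  funext p
  simp only [spin_apply, Matrix.mul_apply, Finset.mul_sum, Finset.sum_mul]
  rw [Finset.sum_comm]
  exact Finset.sum_congr rfl fun c _ => Finset.sum_congr rfl fun b _ => by ring

/-- `spin` of a negated matrix. -/
theorem spin_neg (Γ : Matrix (Fin 4) (Fin 4) ℂ) (u : Fld L) : spin (-Γ) u = -spin Γ u := by
  funext p
  simp only [spin_apply, Matrix.neg_apply, neg_mul, Finset.sum_neg_distrib, Pi.neg_apply]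

/-- A spin isometry (`Γᴴ Γ = 1`) preserves the site norms. -/
theorem siteSq_spin (Γ : Matrix (Fin 4) (Fin 4) ℂ) (hΓ : Γᴴ * Γ = 1) (u : Fld L) (x : TorusSite 4 L) :
    siteSq (spin Γ u) x = siteSq u x := by
  simp only [siteSq, spin_apply]
  refine Finset.sum_congr rfl fun a _ => ?_
  have hre : ∀ f : Fin 4 → ℂ, (star f ⬝ᵥ f).re = ∑ b, ‖f b‖ ^ 2 := by
    intro f
    rw [dotProduct, Complex.re_sum]
    refine Finset.sum_congr rfl fun i _ => ?_
    rw [Pi.star_apply, Complex.star_def, ← Complex.normSq_eq_conj_mul_self, Complex.ofReal_re,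
      Complex.normSq_eq_norm_sq]
  have h : ∀ α, ∑ β, Γ α β * u (x, a, β) = (Γ *ᵥ fun β => u (x, a, β)) α := fun α => rfl
  simp only [h]
  rw [← hre, ← hre, star_mulVec, ← dotProduct_mulVec, mulVec_mulVec, hΓ, one_mulVec]

section SpinInner

variable [NeZero L]

/-- The adjoint of `spin Γ` is `spin Γᴴ`. -/
theorem ip_spin (Γ : Matrix (Fin 4) (Fin 4) ℂ) (w u : Fld L) :
    ip w (spin Γ u) = ip (spin Γᴴ w) u := by
  simp only [ip, spin_apply, Fintype.sum_prod_type, map_sum, map_mul, Matrix.conjTranspose_apply,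
    Complex.star_def, Complex.conj_conj, Finset.mul_sum, Finset.sum_mul]
  refine Finset.sum_congr rfl fun x _ => Finset.sum_congr rfl fun a _ => ?_
  rw [Finset.sum_comm]
  exact Finset.sum_congr rfl fun α _ => Finset.sum_congr rfl fun β _ => by ring

/-- A spin isometry preserves the `ℓ²` norm. -/
theorem nsq_spin (Γ : Matrix (Fin 4) (Fin 4) ℂ) (hΓ : Γᴴ * Γ = 1) (u : Fld L) :
    nsq (spin Γ u) = nsq u := by
  simp only [nsq_eq_sum_siteSq, siteSq_spin Γ hΓ]

end SpinInner



end Summit.QuantumFields.QCD.Theorems.WilsonLichnerowicz
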